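import Summits.Ventures.CertifiedQuantumChemistry.Rows.DifferencePencilRows
import Summits.Ventures.CertifiedQuantumChemistry.Rows.ModelPin
import HarnessLib

/-!
# Ventures/CertifiedQuantumChemistry — Rows/LinearCombination.lean: API of the exact-ℚ LINEAR
# COMBINATION object `Model.lincomb α β F G = α·F + β·G` and its MODEL-PIN record (kind `lincomb`)

HONEST FRAMING (verbatim): certified bounds for a stated model Hamiltonian in a stated basis; not a
claim about the real molecule or material beyond that model.

The combination object itself — `Model.lincomb α β F G : Model k` (tables `α·F.h + β·G.h`,
`α·F.eri + β·G.eri`, `α·F.ecore + β·G.ecore`), `Model.lincomb_isSymmetric` and the bridge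
`Model.hamiltonian_lincomb : (lincomb α β F G).hamiltonian = (α:ℂ)•F.hamiltonian + (β:ℂ)•G.hamiltonian`
— is `Rows/DifferencePencilRows.lean` (chem-type-09, p458740), together with the `dE-direct:d` pencil
soundness theorems that consume it (lead memo `chem-lead/IDIFF-SHAPE-A.md` R-A2/R-A3). By the lead's
slot ruling (cell INBOX 2026-08-26T16:57:58Z) and the split agreed with chem-type-09 (INBOX 17:16Z /
17:33Z) this file, by chem-type-01, carries the rest of the object's API that the file-combination tool
(`fcidump-lincomb`, chem-model-7), the solver seat (chem-solver-4) and the referees use, WITHOUT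
re-declaring anything:

* table-level `simp` lemmas `Model.lincomb_h / lincomb_eri / lincomb_ecore`, structure extensionality
  `Model.ext'` (two models with the same three tables are equal — the identification step between a
  literal `Hamiltonians/K.lean` file and `Model.lincomb α β F G`), and the span algebra
  `lincomb_one_zero`, `lincomb_zero_one`, `lincomb_swap`, `lincomb_lincomb` (a combination of two
  combinations of `F, G` is again a combination of `F, G` — pencils of pencils, grid refinement,
  re-centring never leave the two-file span);
* expectation linearity `Model.rayleigh_lincomb` / `Model.re_rayleigh_lincomb` /
  `Model.hamiltonian_lincomb_mulVec` (`⟨ψ, H_K ψ⟩ = α⟨ψ, H_F ψ⟩ + β⟨ψ, H_G ψ⟩` for every Fock vector);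
* **`Model.energy_lincomb_ge`** and **`LowerRow.lincomb`**: for NON-NEGATIVE coefficients the sector
  ground energy is superadditive, `α·E₀(F; a,b) + β·E₀(G; a,b) ≤ E₀(α·F + β·G; a,b)` (the ground state of
  the combination is a trial state for each parent — concavity of `E₀` in the tables, cf.
  `Rows/SectorEnergyConcavity.lean` in line form), hence two certified lower rows of the parents give a
  FREE certified lower row `α·L_F + β·L_G` of every non-negative combination file (a sanity floor for
  `K`-file certificates; the pencil files `c·F_A − F_B` of `dE-direct:d` have a negative coefficient and
  are NOT covered — that is what `energy_pencil_le` of `DifferencePencilRows.lean` is for);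
* the MODEL-PIN record of a combination file, `LincombPin` (kind `lincomb` of FORMAT-pin1 / R-A2: the
  file's own `ModelPin` of `Rows/ModelPin.lean` + the two parents' pins + the exact coefficients), its
  Lean-checkable well-formedness `LincombPin.IsConsistent` (equal `norb`, core constants combine), and
  the identification predicate `Model.IsLincombOf K P F G` (`K = lincomb P.coeffA P.coeffB F G`) with
  its consequences for `H_K` and the symmetry rule. The hash identities are, as for every pin, reader
  facts quoted in claim-node docstrings, never kernel statements.

Nothing here asserts any bound unconditionally; no definition has analytic content beyond ℚ-linear
algebra and record keeping.
-/

noncomputable section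

namespace Summit.Ventures.CertifiedQuantumChemistry

open Matrix Finset
open Literature.MathematicalPhysics.QuantumLattice Literature.MathematicalPhysics.QuantumChemistry
open scoped ComplexOrder

namespace Model

variable {k : ℕ}

/-! ## Table-level API of `Model.lincomb` -/

/-- One-electron table of the combination (by definition). -/
@[simp] theorem lincomb_h (α β : ℚ) (F G : Model k) (p q : Fin k) :
    (lincomb α β F G).h p q = α * F.h p q + β * G.h p q := rfl

/-- Two-electron table of the combination (by definition). -/
@[simp] theorem lincomb_eri (α β : ℚ) (F G : Model k) (p q r s : Fin k) :
    (lincomb α β F G).eri p q r s = α * F.eri p q r s + β * G.eri p q r s := rfl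

/-- Core constant of the combination (by definition). -/
@[simp] theorem lincomb_ecore (α β : ℚ) (F G : Model k) :
    (lincomb α β F G).ecore = α * F.ecore + β * G.ecore := rfl

/-- Two model files with the same three tables are the same model (structure extensionality; the
identification step between a literal `K`-file and `Model.lincomb α β F G`, closed by `decide`/`rfl` on
small literal tables). -/
theorem ext' {F G : Model k} (hh : F.h = G.h) (he : F.eri = G.eri) (hc : F.ecore = G.ecore) : F = G := by
  cases F
  cases G
  cases hh
  cases he
  cases hc
  rfl

/-- The combination with coefficients `(1, 0)` is the first parent. -/
theorem lincomb_one_zero (F G : Model k) : lincomb 1 0 F G = F :=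
  ext' (funext fun p => funext fun q => by simp) (funext fun p => funext fun q => funext fun r =>
    funext fun s => by simp) (by simp)

/-- The combination with coefficients `(0, 1)` is the second parent. -/
theorem lincomb_zero_one (F G : Model k) : lincomb 0 1 F G = G :=
  ext' (funext fun p => funext fun q => by simp) (funext fun p => funext fun q => funext fun r =>
    funext fun s => by simp) (by simp)

/-- Swapping the parents swaps the coefficients. -/
theorem lincomb_swap (α β : ℚ) (F G : Model k) : lincomb β α G F = lincomb α β F G :=
  ext' (funext fun p => funext fun q => by simp [add_comm]) (funext fun p => funext fun q =>
    funext fun r => funext fun s => by simp [add_comm]) (by simp [add_comm])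

/-- **The two-file span is closed under combination**: a combination of two combinations of `F, G` is
the combination of `F, G` with the composed coefficients (pencils of pencils, grid refinement of a
segment, re-centring — none leaves the span; the `fcidump-lincomb` tool never needs a third parent). -/
theorem lincomb_lincomb (α β α₁ β₁ α₂ β₂ : ℚ) (F G : Model k) :
    lincomb α β (lincomb α₁ β₁ F G) (lincomb α₂ β₂ F G) =
      lincomb (α * α₁ + β * α₂) (α * β₁ + β * β₂) F G :=
  ext' (funext fun p => funext fun q => by simp only [lincomb_h]; ring)
    (funext fun p => funext fun q => funext fun r => funext fun s => by simp only [lincomb_eri]; ring)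
    (by simp only [lincomb_ecore]; ring)

/-! ## Expectations in a combination file -/

/-- `H_K ψ = α·H_F ψ + β·H_G ψ` for every Fock vector (operator linearity applied to a vector; in
particular `H_K` maps each `(N_α, N_β)` sector into itself, as `H_F`, `H_G` do). -/
theorem hamiltonian_lincomb_mulVec (α β : ℚ) (F G : Model k) (ψ : Fock (Orb (Fin k))) :
    (lincomb α β F G).hamiltonian *ᵥ ψ =
      ((α : ℚ) : ℂ) • (F.hamiltonian *ᵥ ψ) + ((β : ℚ) : ℂ) • (G.hamiltonian *ᵥ ψ) := by
  rw [hamiltonian_lincomb, add_mulVec, Matrix.smul_mulVec, Matrix.smul_mulVec]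

/-- **Expectations are the same combination**: `⟨ψ, H_K ψ⟩ = α⟨ψ, H_F ψ⟩ + β⟨ψ, H_G ψ⟩` for every
Fock vector `ψ` (any sector, any norm) — the identity each Rayleigh step of a pencil / window argument
uses. -/
theorem rayleigh_lincomb (α β : ℚ) (F G : Model k) (ψ : Fock (Orb (Fin k))) :
    star ψ ⬝ᵥ (lincomb α β F G).hamiltonian *ᵥ ψ =
      ((α : ℚ) : ℂ) * (star ψ ⬝ᵥ F.hamiltonian *ᵥ ψ) +
        ((β : ℚ) : ℂ) * (star ψ ⬝ᵥ G.hamiltonian *ᵥ ψ) := by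
  rw [hamiltonian_lincomb_mulVec, dotProduct_add, dotProduct_smul, dotProduct_smul, smul_eq_mul,
    smul_eq_mul]

/-- Real parts: `Re⟨ψ, H_K ψ⟩ = α·Re⟨ψ, H_F ψ⟩ + β·Re⟨ψ, H_G ψ⟩` (rational, hence real, coefficients)
— the form `sectorGroundEnergy_le_of_rayleigh` / `sectorGroundEnergy_mul_le_re_rayleigh` consume. -/
theorem re_rayleigh_lincomb (α β : ℚ) (F G : Model k) (ψ : Fock (Orb (Fin k))) :
    (star ψ ⬝ᵥ (lincomb α β F G).hamiltonian *ᵥ ψ).re =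
      (α : ℝ) * (star ψ ⬝ᵥ F.hamiltonian *ᵥ ψ).re + (β : ℝ) * (star ψ ⬝ᵥ G.hamiltonian *ᵥ ψ).re := by
  rw [rayleigh_lincomb, Complex.add_re, ← Complex.ofReal_ratCast, ← Complex.ofReal_ratCast,
    Complex.re_ofReal_mul, Complex.re_ofReal_mul]

/-! ## Non-negative combinations: the sector energy is superadditive -/

/-- **`α·E₀(F; a,b) + β·E₀(G; a,b) ≤ E₀(α·F + β·G; a,b)` for `0 ≤ α, β`** and symmetric `F`, `G` on the
range `a, b ≤ k`: the sector ground state `ψ` of the combination is a trial state for `H_F` and for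
`H_G` (Rayleigh–Ritz twice), and `⟨ψ, H_K ψ⟩ = α⟨ψ, H_F ψ⟩ + β⟨ψ, H_G ψ⟩`. (Concavity of `E₀` in the
integral tables; the line form is `Rows/SectorEnergyConcavity.lean`'s `concaveOn_sectorGroundEnergy_line`.
Negative coefficients — the pencil files of `dE-direct:d` — are NOT covered: see `energy_pencil_le`.) -/
theorem energy_lincomb_ge {F G : Model k} (hF : F.IsSymmetric) (hG : G.IsSymmetric) {a b : ℕ}
    (ha : a ≤ k) (hb : b ≤ k) {α β : ℚ} (hα : 0 ≤ α) (hβ : 0 ≤ β) :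
    (α : ℝ) * F.energy a b + (β : ℝ) * G.energy a b ≤ (lincomb α β F G).energy a b := by
  have hK : (lincomb α β F G).IsSymmetric := lincomb_isSymmetric hF hG
  obtain ⟨ψ, hψ, hψ1, hHψ⟩ := exists_unit_eigen_sectorGroundEnergy
    (Model.hamiltonian_isHermitian hK) (by simpa using ha) (by simpa using hb)
  change (lincomb α β F G).hamiltonian *ᵥ ψ =
    ((sectorGroundEnergy (lincomb α β F G).hamiltonian a b : ℝ) : ℂ) • ψ at hHψ
  have hnorm : (star ψ ⬝ᵥ ψ).re = 1 := by rw [hψ1, Complex.one_re]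
  -- the combination's ground energy is the expectation in ψ
  have hK' : (star ψ ⬝ᵥ (lincomb α β F G).hamiltonian *ᵥ ψ).re = (lincomb α β F G).energy a b := by
    simp only [Model.energy]
    rw [hHψ, dotProduct_smul, hψ1, smul_eq_mul, mul_one, Complex.ofReal_re]
  -- Rayleigh–Ritz for each parent in the same sector
  have hA : F.energy a b ≤ (star ψ ⬝ᵥ F.hamiltonian *ᵥ ψ).re := by
    have h := sectorGroundEnergy_mul_le_re_rayleigh (Model.hamiltonian_isHermitian hF) hψ
    simp only [Model.energy]
    rwa [hnorm, mul_one] at h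
  have hB : G.energy a b ≤ (star ψ ⬝ᵥ G.hamiltonian *ᵥ ψ).re := by
    have h := sectorGroundEnergy_mul_le_re_rayleigh (Model.hamiltonian_isHermitian hG) hψ
    simp only [Model.energy]
    rwa [hnorm, mul_one] at h
  rw [← hK', re_rayleigh_lincomb]
  have hα' : (0 : ℝ) ≤ (α : ℝ) := by exact_mod_cast hα
  have hβ' : (0 : ℝ) ≤ (β : ℝ) := by exact_mod_cast hβ
  exact add_le_add (mul_le_mul_of_nonneg_left hA hα') (mul_le_mul_of_nonneg_left hB hβ')

/-- **A free certified lower row of every non-negative combination file**: certified lower rows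
`L_F ≤ E₀(F; a,b)` and `L_G ≤ E₀(G; a,b)` and `0 ≤ α, β` give `LowerRow (α·F + β·G) a b (α·L_F + β·L_G)`
(sanity floor for combination-file certificates; never informative by itself). -/
theorem _root_.Summit.Ventures.CertifiedQuantumChemistry.LowerRow.lincomb {F G : Model k}
    (hF : F.IsSymmetric) (hG : G.IsSymmetric) {a b : ℕ} {loF loG α β : ℚ} (hα : 0 ≤ α) (hβ : 0 ≤ β)
    (hA : LowerRow F a b loF) (hB : LowerRow G a b loG) :
    LowerRow (lincomb α β F G) a b (α * loF + β * loG) := by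
  refine ⟨hA.1, hA.2.1, ?_⟩
  have h := energy_lincomb_ge hF hG hA.1 hA.2.1 hα hβ
  have h1 := hA.le
  have h2 := hB.le
  have hα' : (0 : ℝ) ≤ (α : ℝ) := by exact_mod_cast hα
  have hβ' : (0 : ℝ) ≤ (β : ℝ) := by exact_mod_cast hβ
  have h3 : (α : ℝ) * ((loF : ℚ) : ℝ) + (β : ℝ) * ((loG : ℚ) : ℝ) ≤
      (α : ℝ) * F.energy a b + (β : ℝ) * G.energy a b :=
    add_le_add (mul_le_mul_of_nonneg_left h1 hα') (mul_le_mul_of_nonneg_left h2 hβ')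
  have h4 : (((α * loF + β * loG : ℚ)) : ℝ) = (α : ℝ) * ((loF : ℚ) : ℝ) + (β : ℝ) * ((loG : ℚ) : ℝ) := by
    simp only [Rat.cast_add, Rat.cast_mul]
  rw [h4]
  exact le_trans h3 h

end Model

/-! ## The MODEL-PIN record of a combination file (FORMAT-pin1 kind `lincomb`, IDIFF-SHAPE-A R-A2) -/

/-- **MODEL-PIN of a COMBINATION file** (kind `lincomb`): the file's own pin (hashes of the bytes the
`fcidump-lincomb` tool wrote and of their canonical JSON), the pins of the two PARENT files, and the exact
rational coefficients `(coeffA, coeffB)` — the provenance a `dE-direct:d` row must name ("the row names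
`F_A`, `F_B`, `K⁺_μ`, `K⁻_ν` (all four fcidump_sha256 + model_sha256), `μ`, `ν` as exact rationals",
IDIFF-SHAPE-A §4). A record; it asserts nothing. -/
structure LincombPin where
  /-- the combination file itself (artefact + mathematics hashes, header integers, core constant) -/
  pin : ModelPin
  /-- pin of the first parent `F_A` -/
  parentA : ModelPin
  /-- pin of the second parent `F_B` -/
  parentB : ModelPin
  /-- exact rational coefficient of the first parent -/
  coeffA : ℚ
  /-- exact rational coefficient of the second parent -/
  coeffB : ℚ

namespace LincombPin

/-- The Lean-checkable CONSISTENCY of a `lincomb` pin: the three pins are well-formed, the three files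
live on the same number of spatial orbitals, and the printed core constant of the combination is the
combination of the parents' core constants (term-by-term combination in ℚ, R-A2). The hash VALUES are
reader facts, not kernel statements. -/
def IsConsistent (P : LincombPin) : Prop :=
  P.pin.IsWellFormed ∧ P.parentA.IsWellFormed ∧ P.parentB.IsWellFormed ∧
    P.parentA.norb = P.pin.norb ∧ P.parentB.norb = P.pin.norb ∧
    P.pin.ecore = P.coeffA * P.parentA.ecore + P.coeffB * P.parentB.ecore

/-- The pencil pins of `dE-direct:d` have coefficients `(c, −1)` with `c = 1 + μ ≥ 1`
(`K⁺_μ = (1+μ)·F_A − F_B`; IDIFF-SHAPE-A §2). A predicate on the record only. -/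
def IsPencil (P : LincombPin) : Prop := 1 ≤ P.coeffA ∧ P.coeffB = -1

/-- The segment pins of class (b) have coefficients `(1 − s, s)` with `0 ≤ s ≤ 1`
(`Model.hamiltonian_segment`). A predicate on the record only. -/
def IsSegment (P : LincombPin) : Prop := 0 ≤ P.coeffB ∧ P.coeffB ≤ 1 ∧ P.coeffA = 1 - P.coeffB

end LincombPin

namespace Model

variable {k : ℕ}

/-- **"This literal model IS the combination the pin names"**: `K = lincomb coeffA coeffB F G` for the
literal parents `F`, `G` (closed by `Model.ext'` + `decide`/`norm_num` on small literal tables, or carried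
as a claim node quoting the three `model_sha256` at large `k`, exactly like `Model.MatchesPin`). -/
def IsLincombOf (K : Model k) (P : LincombPin) (F G : Model k) : Prop :=
  K = lincomb P.coeffA P.coeffB F G

/-- A file identified as a combination has the combined Hamiltonian
`H_K = coeffA·H_F + coeffB·H_G` (`Model.hamiltonian_lincomb`). -/
theorem IsLincombOf.hamiltonian {K F G : Model k} {P : LincombPin} (h : K.IsLincombOf P F G) :
    K.hamiltonian = ((P.coeffA : ℚ) : ℂ) • F.hamiltonian + ((P.coeffB : ℚ) : ℂ) • G.hamiltonian := by
  rw [h, hamiltonian_lincomb]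

/-- A file identified as a combination of symmetric parents is symmetric (so `lowerRow_of_certificate`
applies to its certificates). -/
theorem IsLincombOf.isSymmetric {K F G : Model k} {P : LincombPin} (h : K.IsLincombOf P F G)
    (hF : F.IsSymmetric) (hG : G.IsSymmetric) : K.IsSymmetric := by
  rw [h]
  exact lincomb_isSymmetric hF hG

/-- A file identified as a combination has the combined core constant (the ℚ-identity a referee checks
against the pin's `ecore` field, `LincombPin.IsConsistent`). -/
theorem IsLincombOf.ecore {K F G : Model k} {P : LincombPin} (h : K.IsLincombOf P F G) :
    K.ecore = P.coeffA * F.ecore + P.coeffB * G.ecore := by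
  rw [h, lincomb_ecore]

/-- Transport of a lower row along the identification: a certified lower row of the literal `K`-file is
a lower row of `lincomb coeffA coeffB F G` — the hypothesis shape of the pencil soundness theorems of
`Rows/DifferencePencilRows.lean` (`diffLowerRow_of_pencil_of_upperRow` & co.). -/
theorem IsLincombOf.lowerRow {K F G : Model k} {P : LincombPin} (h : K.IsLincombOf P F G) {a b : ℕ}
    {lo : ℚ} (hK : LowerRow K a b lo) : LowerRow (lincomb P.coeffA P.coeffB F G) a b lo := by
  rw [← h]
  exact hK

end Model

end Summit.Ventures.CertifiedQuantumChemistry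

end
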